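import Literature.NumberTheory.LFunctions.ExceptionalCharacters
import Literature.NumberTheory.Sieve.FriedlanderIwaniecPrimesInfinitude
import HarnessLib

/-!
# Exceptional characters ⇒ primes of the form `a² + b⁸` (Merikoski 2024, the lower-bound illusory sieve)

Statement layer for the «illusory world» column (conditional consequences of exceptional
characters), topic «prime values of polynomials / the illusory sieve». Source: J. Merikoski,
*Exceptional characters and prime numbers in sparse sets*, Algebra & Number Theory 18 (2024)
1305–1332 [Merikoski2024ExceptionalCharacters]; held copy = arXiv:2108.01355 (tex), §1 Theorem 1
(labelled `maintheorem`), the display defining `κ_n`, Remark 1, and §4 Theorem (`generaltheorem`).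

The HYPOTHESIS of the paper — infinitely many primitive real characters `χ_D` with
`L(1, χ_D) ≤ (log D)^{−100}` (§1 (1.1)) — is already the tree's parametrised predicate
`Literature.NumberTheory.LFunctions.ExceptionalCharactersOfStrength 100`
(`ExceptionalCharacters.lean`, which cites exactly this display). This file adds the paper's
THEOREM, which the tree so far only quoted as context (`FordMaynardPrimeSieves.lean`,
`ExceptionalCharacters.lean`):

* `Merikoski2024.kappa n = κ_n = ∫₀¹ (1 − tⁿ)^{1/2} dt` and
  `Merikoski2024.primeSum x = ∑∑_{a, b ≥ 1, a² + b⁸ ≤ x} Λ(a² + b⁸)` (pairs counted with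
  multiplicity, exactly as the printed double sum; cf. the tree's
  `Literature.NumberTheory.Sieve.friedlanderIwaniecSum` for `a² + b⁴`);
* `merikoski2024_theorem1` — NAMED FACT, Theorem 1 AS PRINTED (its quantitative clause): if
  `L(1, χ_D) ≤ (log D)^{−100}` then for `exp((log D)^{10}) < x < exp((log D)^{16})`,
  `(0.189 − o(1)) (4/π) κ₈ x^{5/8} ≤ ∑∑ Λ(a² + b⁸) ≤ (1 + o(1)) (4/π) κ₈ x^{5/8}`, the `o(1)`
  read as «`→ 0` as `D → ∞`, uniformly in `χ_D` and in `x` in the window» (`∀ ε ∃ D₀`);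
* PROVED: `Merikoski2024.kappa_pos`; the private lemmas `primeSum_le_sum_prime_add` and
  `log_mul_card_le_rpow` (the prime powers `p^k = a² + b⁸`, `k ≥ 2`, contribute
  `≤ 38784 x^{29/48} = o(x^{5/8})`, via the injection `(a, b) ↦ (a, b²)` into the solutions of
  `a² + c⁴ = p^k` counted in `Literature.NumberTheory.Sieve.FriedlanderIwaniecPrimesInfinitude`);
  and the paper's headline, **`Merikoski2024.setOf_prime_sq_add_pow_eight_infinite`**:
  `merikoski2024_theorem1 → ExceptionalCharactersOfStrength 100 →
  {p prime : p = a² + b⁸, a, b ≥ 1}.Infinite` — Theorem 1's first sentence («If there are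
  infinitely many exceptional primitive characters `χ`, then there are infinitely many prime
  numbers of the form `a² + b⁸`») DERIVED from its quantitative clause, so that only the latter is
  vendored.

Index only (not typed): the general lower-bound illusory sieve, §4 Theorem (arXiv Theorem 15:
non-negative sequences `a_n`, `b_n` with exponent of distribution `2/3 − γ`, `γ < 1/6`, in the sense
of the paper's Propositions 2.x, give `∑ Λ(n) a_n ≥ (1 − 2 log((1+3γ)/(1−6γ)) − O(L(1,χ_D) log⁵x)
− o(1)) ∑ Λ(n) b_n`; non-trivial for level `> (1+√e)/(1+2√e) = 0.61634…`) — its hypotheses refer to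
the paper's internal propositions and are not stated in closed form there; Remark 9 (primes in
short intervals shorter than `x^{39/79}` under exceptional characters, «details will appear
elsewhere»).

LABEL: instrument / statement layer. WHAT THIS IS NOT: no claim that exceptional characters exist;
the theorem is vacuous under GRH (`not_exceptionalCharactersOfStrength_of_noSiegelZeros`); nothing
here bears on the parity problem for `a² + b⁸` unconditionally.

## References

* [Merikoski2024ExceptionalCharacters] J. Merikoski, *Exceptional characters and prime numbers in
  sparse sets*, Algebra Number Theory 18 (2024), no. 7, 1305–1332, doi:10.2140/ant.2024.18.1305
  = arXiv:2108.01355: §1 (1.1), Theorem 1, Remark 1; §4 Theorem (general version), Remarks 7–9.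
* [FriedlanderIwaniec2005IllusorySieve] J. Friedlander, H. Iwaniec, *The illusory sieve*, Int. J.
  Number Theory 1 (2005) 459–494 (the asymptotic illusory sieve for `a² + b⁶`; context, §1).
* [FriedlanderIwaniecAnnals1998] J. Friedlander, H. Iwaniec, *The polynomial `X² + Y⁴` captures
  its primes*, Ann. of Math. 148 (1998) 945–1040 (the constant `4π⁻¹κ`, (1.1)–(1.2); context).
-/

noncomputable section

open Finset Real
open scoped ArithmeticFunction.vonMangoldt

namespace Literature.NumberTheory.LFunctions

namespace Merikoski2024

/-- `κ_n := ∫₀¹ √(1 − tⁿ) dt` (so `κ₂ = π/4`, `κ₄` is the Friedlander–Iwaniec constant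
`Literature.NumberTheory.Sieve.friedlanderIwaniecKappa`, and `(4/π) κ₈ = κ₈/κ₂`).
[cite: Merikoski2024ExceptionalCharacters, §1, display before Theorem 1, and Remark 1] -/
def kappa (n : ℕ) : ℝ := ∫ t in (0 : ℝ)..1, Real.sqrt (1 - t ^ n)

/-- `κ_n > 0` for every `n ≥ 1` (the integrand is positive on `(0, 1)`; Remark 1: `κ₂ = π/4`, and
`(4/π) κ₈ x^{5/8}` «is the expected main term»). [cite: Merikoski2024ExceptionalCharacters, §1 Remark 1] -/
theorem kappa_pos {n : ℕ} (hn : 1 ≤ n) : 0 < kappa n := by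
  unfold kappa
  refine intervalIntegral.intervalIntegral_pos_of_pos_on ?_ ?_ zero_lt_one
  · exact ((continuous_const.sub (continuous_pow n)).sqrt).intervalIntegrable _ _
  · intro t ht
    apply Real.sqrt_pos.mpr
    have : t ^ n < 1 := pow_lt_one₀ ht.1.le ht.2 (by omega)
    linarith

/-- The printed double sum `∑∑_{a² + b⁸ ≤ x, a, b > 0} Λ(a² + b⁸)` (pairs `(a, b)` of positive
integers counted with multiplicity), at an integer `x`. [cite: Merikoski2024ExceptionalCharacters, §1 Theorem 1 (the displayed sums)] -/
def primeSum (x : ℕ) : ℝ :=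
  ∑ a ∈ Icc 1 x, ∑ b ∈ Icc 1 x, if a ^ 2 + b ^ 8 ≤ x then Λ (a ^ 2 + b ^ 8) else 0

end Merikoski2024

/-- **Merikoski 2024, Theorem 1** (primes `a² + b⁸` under exceptional characters; the
quantitative clause, AS PRINTED): «if `L(1, χ_D) ≤ log^{−100} D`, then for
`exp(log^{10} D) < x < exp(log^{16} D)` we have
`∑∑_{a² + b⁸ ≤ x, a, b > 0} Λ(a² + b⁸) ≥ (0.189 − o(1)) · (4/π) κ₈ x^{5/8}` and
`∑∑_{a² + b⁸ ≤ x, a, b > 0} Λ(a² + b⁸) ≤ (1 + o(1)) · (4/π) κ₈ x^{5/8}`», `χ_D` the primitive real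
character of a fundamental discriminant `±D` (here: a primitive quadratic Dirichlet character
`χ ≠ 1` of modulus `D`, `‖L(1, χ)‖` for the real number `L(1, χ_D)`), the two `o(1)` read as
«for every `ε > 0`, once `D ≥ D₀(ε)`, uniformly in `χ` and in `x` in the window». UNPROVED
named fact (the paper's proof: the lower-bound illusory sieve with exponent of distribution
`5/8 − ε`, §§2–3). Its qualitative first sentence is DERIVED below
(`Merikoski2024.setOf_prime_sq_add_pow_eight_infinite`). [cite: Merikoski2024ExceptionalCharacters, §1 Theorem 1] -/
def merikoski2024_theorem1 : Prop :=
  ∀ ε : ℝ, 0 < ε → ∃ D₀ : ℕ, ∀ (D : ℕ) [NeZero D] (χ : DirichletCharacter ℂ D),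
    D₀ ≤ D → χ.IsPrimitive → χ ≠ 1 → χ.IsQuadratic →
    ‖χ.LFunction 1‖ ≤ Real.log D ^ (-(100 : ℝ)) →
    ∀ x : ℝ, Real.exp (Real.log D ^ 10) < x → x < Real.exp (Real.log D ^ 16) →
      (0.189 - ε) * (4 / Real.pi * Merikoski2024.kappa 8) * x ^ (5 / 8 : ℝ) ≤
          Merikoski2024.primeSum ⌊x⌋₊ ∧
        Merikoski2024.primeSum ⌊x⌋₊ ≤
          (1 + ε) * (4 / Real.pi * Merikoski2024.kappa 8) * x ^ (5 / 8 : ℝ)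

namespace Merikoski2024

open Literature.NumberTheory.Sieve

/-! ### The prime powers `a² + b⁸ = p^k`, `k ≥ 2`, contribute `o(x^{5/8})`

`a² + b⁸ = a² + (b²)⁴`, and `b⁸ ≤ x` forces `b² ≤ x`, so `(a, b) ↦ (a, b²)` injects the pairs with
`a² + b⁸` the square (resp. a higher power) of a prime into the corresponding pairs for `a² + c⁴`
counted in `Literature.NumberTheory.Sieve.FriedlanderIwaniecPrimesInfinitude`
(`card_filter_sq_add_pow_four_eq_prime_sq_le`: `≤ 2(2R + 1)²`, `R = ⌊⌊√x⌋^{1/2}⌋`;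
`card_filter_sq_add_pow_four_eq_higher_prime_pow_le`: `≤ #{p ≤ x : p³ ≤ x}(log₂ x + 1)R`). With the
weight `Λ ≤ log x` this is `≪ x^{7/12} log² x ≤ 38784 x^{29/48}`, and `29/48 < 5/8 = 30/48`. -/

/-- The injection `(a, b) ↦ (a, b²)` on pairs. [folklore] -/
private def sqSnd (ab : ℕ × ℕ) : ℕ × ℕ := (ab.1, ab.2 ^ 2)

/-- `(a, b) ↦ (a, b²)` is injective on `ℕ × ℕ`. [folklore] -/
private theorem sqSnd_injective : Function.Injective sqSnd := by
  intro ab cd h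
  simp only [sqSnd, Prod.mk.injEq] at h
  obtain ⟨h1, h2⟩ := h
  exact Prod.ext h1 (Nat.pow_left_injective two_ne_zero h2)

/-- `a² + b⁸ = a² + (b²)⁴`. [folklore] -/
private theorem sq_add_pow_eight_eq (a b : ℕ) : a ^ 2 + b ^ 8 = a ^ 2 + (b ^ 2) ^ 4 := by ring

/-- `b⁸ ≤ x` and `b ≥ 1` give `b² ≤ x`. [folklore] -/
private theorem sq_le_of_pow_eight_le {b x : ℕ} (hb : 1 ≤ b) (h : b ^ 8 ≤ x) : b ^ 2 ≤ x :=
  le_trans (Nat.pow_le_pow_right hb (by norm_num)) h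

/-- The pairs `1 ≤ a, b ≤ x`, `a² + b⁸ ≤ x`, satisfying a property `P(a² + b⁸)` inject under
`(a, b) ↦ (a, b²)` into the pairs `1 ≤ a, c ≤ x`, `a² + c⁴ ≤ x`, with `P(a² + c⁴)`. [folklore] -/
private theorem card_filter_eight_le_card_filter_four (x : ℕ) (P : ℕ → Prop) [DecidablePred P] :
    #{ab ∈ Icc 1 x ×ˢ Icc 1 x | ab.1 ^ 2 + ab.2 ^ 8 ≤ x ∧ P (ab.1 ^ 2 + ab.2 ^ 8)} ≤
      #{ac ∈ Icc 1 x ×ˢ Icc 1 x | ac.1 ^ 2 + ac.2 ^ 4 ≤ x ∧ P (ac.1 ^ 2 + ac.2 ^ 4)} := by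
  refine Finset.card_le_card_of_injOn sqSnd (fun ab hab => ?_) (sqSnd_injective.injOn)
  simp only [coe_filter, mem_product, mem_Icc, Set.mem_setOf_eq] at hab ⊢
  obtain ⟨⟨⟨ha1, hax⟩, ⟨hb1, hbx⟩⟩, hle, hP⟩ := hab
  have hb8 : ab.2 ^ 8 ≤ x := le_trans (Nat.le_add_left _ _) hle
  refine ⟨⟨⟨ha1, hax⟩, ⟨Nat.one_le_pow _ _ hb1, sq_le_of_pow_eight_le hb1 hb8⟩⟩, ?_, ?_⟩
  · simpa [sqSnd, sq_add_pow_eight_eq] using hle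
  · simpa [sqSnd, sq_add_pow_eight_eq] using hP

/-- The sum split by the type of `n = a² + b⁸`:
`∑∑_{a² + b⁸ ≤ x} Λ(a² + b⁸) ≤ ∑∑_{a² + b⁸ ≤ x prime} Λ(a² + b⁸) + log x · (N₂ + N₃)` with
`N₂ ≤ 2(2R + 1)²`, `N₃ ≤ #{p ≤ x : p³ ≤ x}(log₂ x + 1)R`, `R = ⌊⌊√x⌋^{1/2}⌋`, the bounds of
`Literature.NumberTheory.Sieve.FriedlanderIwaniecPrimesInfinitude` for `a² + c⁴` transported along
`(a, b) ↦ (a, b²)`. [folklore] -/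
private theorem primeSum_le_sum_prime_add (x : ℕ) :
    primeSum x ≤
      (∑ ab ∈ Icc 1 x ×ˢ Icc 1 x with (ab.1 ^ 2 + ab.2 ^ 8 ≤ x ∧ (ab.1 ^ 2 + ab.2 ^ 8).Prime),
          Λ (ab.1 ^ 2 + ab.2 ^ 8)) +
        Real.log x * ((2 * (2 * x.sqrt.sqrt + 1) ^ 2 : ℕ) +
          (#{p ∈ range (x + 1) | p ^ 3 ≤ x} * (Nat.log 2 x + 1) * x.sqrt.sqrt : ℕ)) := by
  have hlogx : 0 ≤ Real.log x := Real.log_natCast_nonneg x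
  have hsum : primeSum x =
      ∑ ab ∈ Icc 1 x ×ˢ Icc 1 x,
        (if ab.1 ^ 2 + ab.2 ^ 8 ≤ x then Λ (ab.1 ^ 2 + ab.2 ^ 8) else 0) := by
    rw [primeSum, Finset.sum_product]
  have hpt : ∀ ab ∈ Icc 1 x ×ˢ Icc 1 x,
      (if ab.1 ^ 2 + ab.2 ^ 8 ≤ x then Λ (ab.1 ^ 2 + ab.2 ^ 8) else 0) ≤
        (if (ab.1 ^ 2 + ab.2 ^ 8 ≤ x ∧ (ab.1 ^ 2 + ab.2 ^ 8).Prime) then Λ (ab.1 ^ 2 + ab.2 ^ 8)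
          else 0) +
        Real.log x * (if (ab.1 ^ 2 + ab.2 ^ 8 ≤ x ∧
            ((ab.1 ^ 2 + ab.2 ^ 8).sqrt.Prime ∧ (ab.1 ^ 2 + ab.2 ^ 8).sqrt ^ 2 = ab.1 ^ 2 + ab.2 ^ 8))
            then 1 else 0) +
        Real.log x * (if (ab.1 ^ 2 + ab.2 ^ 8 ≤ x ∧
            (IsPrimePow (ab.1 ^ 2 + ab.2 ^ 8) ∧ ¬ (ab.1 ^ 2 + ab.2 ^ 8).Prime ∧
              ¬ ((ab.1 ^ 2 + ab.2 ^ 8).sqrt.Prime ∧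
                (ab.1 ^ 2 + ab.2 ^ 8).sqrt ^ 2 = ab.1 ^ 2 + ab.2 ^ 8))) then 1 else 0) := by
    intro ab hab
    simp only [mem_product, mem_Icc] at hab
    by_cases hle : ab.1 ^ 2 + ab.2 ^ 8 ≤ x
    · have hn0 : (0 : ℝ) < (ab.1 ^ 2 + ab.2 ^ 8 : ℕ) := by
        exact_mod_cast Nat.add_pos_left (pow_pos hab.1.1 2) _
      have hlogn : Real.log (ab.1 ^ 2 + ab.2 ^ 8 : ℕ) ≤ Real.log x :=
        Real.log_le_log hn0 (by exact_mod_cast hle)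
      have hΛ := vonMangoldt_le_prime_add_sq_add_higher (ab.1 ^ 2 + ab.2 ^ 8)
      have hΛ0 : 0 ≤ Λ (ab.1 ^ 2 + ab.2 ^ 8) := ArithmeticFunction.vonMangoldt_nonneg
      simp only [hle, true_and, if_true]
      split_ifs at hΛ ⊢ <;> linarith
    · simp [hle]
  rw [hsum]
  refine (Finset.sum_le_sum hpt).trans ?_
  rw [Finset.sum_add_distrib, Finset.sum_add_distrib, ← Finset.mul_sum, ← Finset.mul_sum,
    Finset.sum_boole, Finset.sum_boole, ← Finset.sum_filter]
  have h2 : ((#{ab ∈ Icc 1 x ×ˢ Icc 1 x | ab.1 ^ 2 + ab.2 ^ 8 ≤ x ∧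
        ((ab.1 ^ 2 + ab.2 ^ 8).sqrt.Prime ∧
          (ab.1 ^ 2 + ab.2 ^ 8).sqrt ^ 2 = ab.1 ^ 2 + ab.2 ^ 8)} : ℕ) : ℝ) ≤
      (2 * (2 * x.sqrt.sqrt + 1) ^ 2 : ℕ) := by
    have hinj := card_filter_eight_le_card_filter_four x
      (fun n => n.sqrt.Prime ∧ n.sqrt ^ 2 = n)
    exact_mod_cast hinj.trans (card_filter_sq_add_pow_four_eq_prime_sq_le x)
  have h3 : ((#{ab ∈ Icc 1 x ×ˢ Icc 1 x | ab.1 ^ 2 + ab.2 ^ 8 ≤ x ∧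
        (IsPrimePow (ab.1 ^ 2 + ab.2 ^ 8) ∧ ¬ (ab.1 ^ 2 + ab.2 ^ 8).Prime ∧
          ¬ ((ab.1 ^ 2 + ab.2 ^ 8).sqrt.Prime ∧
            (ab.1 ^ 2 + ab.2 ^ 8).sqrt ^ 2 = ab.1 ^ 2 + ab.2 ^ 8))} : ℕ) : ℝ) ≤
      (#{p ∈ range (x + 1) | p ^ 3 ≤ x} * (Nat.log 2 x + 1) * x.sqrt.sqrt : ℕ) := by
    have hinj := card_filter_eight_le_card_filter_four x
      (fun n => IsPrimePow n ∧ ¬ n.Prime ∧ ¬ (n.sqrt.Prime ∧ n.sqrt ^ 2 = n))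
    exact_mod_cast hinj.trans (card_filter_sq_add_pow_four_eq_higher_prime_pow_le x)
  have h2' := mul_le_mul_of_nonneg_left h2 hlogx
  have h3' := mul_le_mul_of_nonneg_left h3 hlogx
  push_cast at h2' h3' ⊢
  linarith

/-- The prime-power part is `O(x^{29/48})`, explicitly: for `x ≥ 1`,
`log x · (2(2R + 1)² + #{p ≤ x : p³ ≤ x}(log₂ x + 1)R) ≤ 38784 x^{29/48}`, using `R ≤ x^{1/4}`,
`#{p : p³ ≤ x} ≤ x^{1/3} + 1`, `log₂ x ≤ 2 log x` and `log x ≤ 96 x^{1/96}`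
(`Real.log_le_rpow_div`); with `q = x^{1/96} ≥ 1` this is the polynomial inequality
`96q(2(2q²⁴ + 1)² + (q³² + 1)(192q + 1)q²⁴) ≤ 38784 q⁵⁸`. (The exponent `7/12` of the count times
`log² x` must stay below `5/8`; `2/3`, as in the tree's `a² + b⁴` version, would not.) [folklore] -/
private theorem log_mul_card_le_rpow (x : ℕ) (hx : 1 ≤ x) :
    Real.log x * ((2 * (2 * x.sqrt.sqrt + 1) ^ 2 : ℕ) +
          (#{p ∈ range (x + 1) | p ^ 3 ≤ x} * (Nat.log 2 x + 1) * x.sqrt.sqrt : ℕ)) ≤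
      38784 * (x : ℝ) ^ (29 / 48 : ℝ) := by
  have hx1 : (1 : ℝ) ≤ x := by exact_mod_cast hx
  have hx0 : (0 : ℝ) < x := by linarith
  have hR : (x.sqrt.sqrt : ℝ) ≤ (x : ℝ) ^ (1 / 4 : ℝ) := by
    have h4 : ((x.sqrt.sqrt : ℕ) : ℝ) ^ 4 ≤ x := by
      have : x.sqrt.sqrt ^ 4 ≤ x := by
        calc x.sqrt.sqrt ^ 4 = (x.sqrt.sqrt ^ 2) ^ 2 := by ring
          _ ≤ x.sqrt ^ 2 := Nat.pow_le_pow_left (Nat.sqrt_le' _) 2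
          _ ≤ x := Nat.sqrt_le' _
      exact_mod_cast this
    calc (x.sqrt.sqrt : ℝ) = (((x.sqrt.sqrt : ℝ)) ^ 4) ^ (4⁻¹ : ℝ) :=
          (Real.pow_rpow_inv_natCast (by positivity) (by norm_num)).symm
      _ ≤ (x : ℝ) ^ (4⁻¹ : ℝ) := Real.rpow_le_rpow (by positivity) h4 (by norm_num)
      _ = (x : ℝ) ^ (1 / 4 : ℝ) := by norm_num
  have hP : (#{p ∈ range (x + 1) | p ^ 3 ≤ x} : ℝ) ≤ (x : ℝ) ^ (1 / 3 : ℝ) + 1 := by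
    have hsub : {p ∈ range (x + 1) | p ^ 3 ≤ x} ⊆ range (⌊(x : ℝ) ^ (1 / 3 : ℝ)⌋₊ + 1) := by
      intro p hp
      simp only [mem_filter, mem_range] at hp
      rw [mem_range, Nat.lt_add_one_iff, Nat.le_floor_iff (by positivity)]
      have h3 : ((p : ℝ)) ^ 3 ≤ x := by exact_mod_cast hp.2
      calc (p : ℝ) = (((p : ℝ)) ^ 3) ^ (3⁻¹ : ℝ) :=
          (Real.pow_rpow_inv_natCast (by positivity) (by norm_num)).symm
        _ ≤ (x : ℝ) ^ (3⁻¹ : ℝ) := Real.rpow_le_rpow (by positivity) h3 (by norm_num)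
        _ = (x : ℝ) ^ (1 / 3 : ℝ) := by norm_num
    calc (#{p ∈ range (x + 1) | p ^ 3 ≤ x} : ℝ)
        ≤ (#(range (⌊(x : ℝ) ^ (1 / 3 : ℝ)⌋₊ + 1)) : ℝ) := by exact_mod_cast card_le_card hsub
      _ = ⌊(x : ℝ) ^ (1 / 3 : ℝ)⌋₊ + 1 := by rw [card_range]; push_cast; ring
      _ ≤ (x : ℝ) ^ (1 / 3 : ℝ) + 1 := by gcongr; exact Nat.floor_le (by positivity)
  have hlog0 : 0 ≤ Real.log x := Real.log_natCast_nonneg x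
  have hL : (Nat.log 2 x : ℝ) ≤ 2 * Real.log x := by
    have h2 : ((2 : ℕ) : ℝ) ^ Nat.log 2 x ≤ x := by
      exact_mod_cast Nat.pow_log_le_self 2 (by omega : x ≠ 0)
    have h2' : (Nat.log 2 x : ℝ) * Real.log 2 ≤ Real.log x := by
      rw [← Real.log_pow]
      exact Real.log_le_log (by positivity) (by exact_mod_cast h2)
    have hlog2 : (1 / 2 : ℝ) < Real.log 2 := by linarith [Real.log_two_gt_d9]
    nlinarith [Nat.cast_nonneg (α := ℝ) (Nat.log 2 x)]
  have hlog : Real.log x ≤ 96 * (x : ℝ) ^ (1 / 96 : ℝ) := by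
    have := Real.log_le_rpow_div hx0.le (by norm_num : (0 : ℝ) < 1 / 96)
    linarith [show (x : ℝ) ^ (1 / 96 : ℝ) / (1 / 96) = 96 * (x : ℝ) ^ (1 / 96 : ℝ) by ring]
  set q := (x : ℝ) ^ (1 / 96 : ℝ) with hq
  have hq1 : 1 ≤ q := Real.one_le_rpow hx1 (by norm_num)
  have h4 : (x : ℝ) ^ (1 / 4 : ℝ) = q ^ 24 := by
    rw [hq, ← Real.rpow_natCast, ← Real.rpow_mul hx0.le]; norm_num
  have h3 : (x : ℝ) ^ (1 / 3 : ℝ) = q ^ 32 := by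
    rw [hq, ← Real.rpow_natCast, ← Real.rpow_mul hx0.le]; norm_num
  have h58 : (x : ℝ) ^ (29 / 48 : ℝ) = q ^ 58 := by
    rw [hq, ← Real.rpow_natCast, ← Real.rpow_mul hx0.le]; norm_num
  rw [h4] at hR
  rw [h3] at hP
  rw [h58]
  push_cast
  set R := ((x.sqrt.sqrt : ℕ) : ℝ) with hRdef
  set P := ((#{p ∈ range (x + 1) | p ^ 3 ≤ x} : ℕ) : ℝ) with hPdef
  set L := ((Nat.log 2 x : ℕ) : ℝ) with hLdef
  have hR0 : 0 ≤ R := by positivity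
  have hP0 : 0 ≤ P := by positivity
  have hL0 : 0 ≤ L := by positivity
  have hL' : L + 1 ≤ 192 * q + 1 := by linarith
  have hq0 : 0 ≤ q := le_trans zero_le_one hq1
  have hmono : ∀ {m n : ℕ}, m ≤ n → q ^ m ≤ q ^ n := fun h => pow_le_pow_right₀ hq1 h
  calc Real.log x * (2 * (2 * R + 1) ^ 2 + P * (L + 1) * R)
      ≤ (96 * q) * (2 * (2 * q ^ 24 + 1) ^ 2 + (q ^ 32 + 1) * (192 * q + 1) * q ^ 24) := by
        gcongr
    _ = 18432 * q ^ 58 + 96 * q ^ 57 + 768 * q ^ 49 + 18432 * q ^ 26 + 864 * q ^ 25 +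
          192 * q := by ring
    _ ≤ 18432 * q ^ 58 + 96 * q ^ 58 + 768 * q ^ 58 + 18432 * q ^ 58 + 864 * q ^ 58 +
          192 * q ^ 58 := by
        have h57 := hmono (show 57 ≤ 58 by norm_num)
        have h49 := hmono (show 49 ≤ 58 by norm_num)
        have h26 := hmono (show 26 ≤ 58 by norm_num)
        have h25 := hmono (show 25 ≤ 58 by norm_num)
        have h1 : q ≤ q ^ 58 := by simpa using hmono (show 1 ≤ 58 by norm_num)
        linarith
    _ = 38784 * q ^ 58 := by ring

/-- The prime part of the sum is bounded when only finitely many primes are `a² + b⁸`: if every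
prime `a² + b⁸` (`a, b ≥ 1`) is `≤ N₀`, then `∑∑_{a² + b⁸ ≤ x prime} Λ(a² + b⁸) ≤ N₀² log N₀`
for every `x`. [folklore] -/
private theorem sum_prime_part_le {N₀ : ℕ}
    (hN₀ : ∀ p ∈ {p : ℕ | p.Prime ∧ ∃ a b : ℕ, 0 < a ∧ 0 < b ∧ p = a ^ 2 + b ^ 8}, p ≤ N₀)
    (x : ℕ) :
    (∑ ab ∈ Icc 1 x ×ˢ Icc 1 x with (ab.1 ^ 2 + ab.2 ^ 8 ≤ x ∧ (ab.1 ^ 2 + ab.2 ^ 8).Prime),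
        Λ (ab.1 ^ 2 + ab.2 ^ 8)) ≤ (N₀ : ℝ) ^ 2 * Real.log N₀ := by
  have hsub : {ab ∈ Icc 1 x ×ˢ Icc 1 x | ab.1 ^ 2 + ab.2 ^ 8 ≤ x ∧ (ab.1 ^ 2 + ab.2 ^ 8).Prime} ⊆
      Icc 1 N₀ ×ˢ Icc 1 N₀ := by
    intro ab hab
    simp only [mem_filter, mem_product, mem_Icc] at hab ⊢
    obtain ⟨⟨⟨ha1, -⟩, ⟨hb1, -⟩⟩, -, hp⟩ := hab
    have hle : ab.1 ^ 2 + ab.2 ^ 8 ≤ N₀ := hN₀ _ ⟨hp, ab.1, ab.2, ha1, hb1, rfl⟩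
    refine ⟨⟨ha1, ?_⟩, ⟨hb1, ?_⟩⟩
    · exact le_trans (Nat.le_self_pow two_ne_zero _) (le_trans (Nat.le_add_right _ _) hle)
    · exact le_trans (Nat.le_self_pow (by norm_num) _) (le_trans (Nat.le_add_left _ _) hle)
  have hterm : ∀ ab ∈ {ab ∈ Icc 1 x ×ˢ Icc 1 x |
      ab.1 ^ 2 + ab.2 ^ 8 ≤ x ∧ (ab.1 ^ 2 + ab.2 ^ 8).Prime},
      Λ (ab.1 ^ 2 + ab.2 ^ 8) ≤ Real.log N₀ := by
    intro ab hab
    simp only [mem_filter, mem_product, mem_Icc] at hab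
    obtain ⟨⟨⟨ha1, -⟩, ⟨hb1, -⟩⟩, -, hp⟩ := hab
    have hle : ab.1 ^ 2 + ab.2 ^ 8 ≤ N₀ := hN₀ _ ⟨hp, ab.1, ab.2, ha1, hb1, rfl⟩
    calc Λ (ab.1 ^ 2 + ab.2 ^ 8) ≤ Real.log (ab.1 ^ 2 + ab.2 ^ 8 : ℕ) :=
          ArithmeticFunction.vonMangoldt_le_log
      _ ≤ Real.log N₀ := Real.log_le_log (by exact_mod_cast hp.pos) (by exact_mod_cast hle)
  refine (Finset.sum_le_card_nsmul _ _ _ hterm).trans ?_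
  rw [nsmul_eq_mul]
  have hcard : ((#{ab ∈ Icc 1 x ×ˢ Icc 1 x |
      ab.1 ^ 2 + ab.2 ^ 8 ≤ x ∧ (ab.1 ^ 2 + ab.2 ^ 8).Prime} : ℕ) : ℝ) ≤ (N₀ : ℝ) * N₀ := by
    have := card_le_card hsub
    rw [card_product, Nat.card_Icc, Nat.add_sub_cancel] at this
    exact_mod_cast this
  have hlogN : 0 ≤ Real.log N₀ := Real.log_natCast_nonneg N₀
  nlinarith

/-- `exp 2 ≤ 8` (so `log D ≥ 2` once `D ≥ 8`). [folklore] -/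
private theorem exp_two_le_eight : Real.exp 2 ≤ 8 := by
  have h := Real.exp_one_lt_d9
  have h0 := Real.exp_pos 1
  rw [show (2 : ℝ) = 1 + 1 by norm_num, Real.exp_add]
  nlinarith

/-- **Merikoski 2024, Theorem 1, first sentence — PROVED from its quantitative clause**: «If there
are infinitely many exceptional primitive characters `χ`, then there are infinitely many prime
numbers of the form `a² + b⁸`.» Here «infinitely many exceptional characters» is the tree's
`ExceptionalCharactersOfStrength 100` (the paper's (1.1)). Proof: otherwise all primes `a² + b⁸`
(`a, b ≥ 1`) are `≤ N₀`, so the prime part of `∑∑ Λ(a² + b⁸)` is `≤ N₀² log N₀` while the prime-power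
part is `≤ 38784 x^{29/48}` (`log_mul_card_le_rpow`); but for an exceptional `χ_D` with `D` large
and the integer `x = ⌊exp((log D)^{10})⌋ + 1` (inside the window, as `log D ≥ 2`) Theorem 1 with
`ε = 0.089` gives `∑∑ Λ ≥ (1/10)(4/π)κ₈ x^{5/8}`, and `x^{5/8} = x^{29/48} · x^{1/48}` with
`x^{1/48} → ∞` — contradiction. [cite: Merikoski2024ExceptionalCharacters, §1 Theorem 1 (first sentence)] -/
theorem setOf_prime_sq_add_pow_eight_infinite (h : merikoski2024_theorem1)
    (hE : ExceptionalCharactersOfStrength 100) :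
    {p : ℕ | p.Prime ∧ ∃ a b : ℕ, 0 < a ∧ 0 < b ∧ p = a ^ 2 + b ^ 8}.Infinite := by
  by_contra hfin
  have hfin' : {p : ℕ | p.Prime ∧ ∃ a b : ℕ, 0 < a ∧ 0 < b ∧ p = a ^ 2 + b ^ 8}.Finite :=
    Set.not_infinite.mp hfin
  obtain ⟨N₀, hN₀⟩ := hfin'.bddAbove
  have hN₀' : ∀ p ∈ {p : ℕ | p.Prime ∧ ∃ a b : ℕ, 0 < a ∧ 0 < b ∧ p = a ^ 2 + b ^ 8}, p ≤ N₀ :=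
    fun p hp => hN₀ hp
  -- the prime part of the sum is bounded, the prime-power part is `≤ 38784 x^{29/48}`
  set M : ℝ := (N₀ : ℝ) ^ 2 * Real.log N₀ with hM
  have hM0 : 0 ≤ M := by positivity
  have hub : ∀ x : ℕ, 1 ≤ x → primeSum x ≤ M + 38784 * (x : ℝ) ^ (29 / 48 : ℝ) := by
    intro x hx
    calc primeSum x ≤ _ := primeSum_le_sum_prime_add x
      _ ≤ M + 38784 * (x : ℝ) ^ (29 / 48 : ℝ) :=
          add_le_add (sum_prime_part_le hN₀' x) (log_mul_card_le_rpow x hx)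
  -- the constant of the lower bound, with `ε = 0.089`
  set c : ℝ := (0.189 - 0.089) * (4 / Real.pi * kappa 8) with hc
  have hκ : 0 < kappa 8 := kappa_pos (by norm_num)
  have hc0 : 0 < c := by
    have : (0 : ℝ) < 0.189 - 0.089 := by norm_num
    positivity
  set K : ℝ := (M + 38784) / c with hK
  have hK0 : 0 ≤ K := by positivity
  -- choose an exceptional character of large modulus
  obtain ⟨D₀, hD₀⟩ := h 0.089 (by norm_num)
  obtain ⟨D, hDne, χ, hDge, hprim, hne, hquad, hL⟩ := hE (max D₀ (max 8 (⌈K ^ (48 : ℕ)⌉₊ + 1)))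
  have hD₀D : D₀ ≤ D := le_trans (le_max_left _ _) hDge
  have hD8 : 8 ≤ D := le_trans (le_trans (le_max_left _ _) (le_max_right _ _)) hDge
  have hDK : ⌈K ^ (48 : ℕ)⌉₊ + 1 ≤ D :=
    le_trans (le_trans (le_max_right _ _) (le_max_right _ _)) hDge
  have hD8' : (8 : ℝ) ≤ D := by exact_mod_cast hD8
  have hDpos : (0 : ℝ) < D := by linarith
  -- `log D ≥ 2`
  have hlogD : 2 ≤ Real.log D := by
    rw [Real.le_log_iff_exp_le hDpos]
    exact exp_two_le_eight.trans hD8'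
  have hlogD1 : 1 ≤ Real.log D := by linarith
  set Lg : ℝ := Real.log D with hLg
  -- the integer `x = ⌊exp(Lg^10)⌋ + 1` lies in the window
  set x : ℕ := ⌊Real.exp (Lg ^ 10)⌋₊ + 1 with hxdef
  have hxlow : Real.exp (Lg ^ 10) < (x : ℝ) := by
    rw [hxdef]; push_cast; exact Nat.lt_floor_add_one _
  have hxle : (x : ℝ) ≤ Real.exp (Lg ^ 10) + 1 := by
    rw [hxdef]; push_cast
    linarith [Nat.floor_le (Real.exp_pos (Lg ^ 10)).le]
  have hxhigh : (x : ℝ) < Real.exp (Lg ^ 16) := by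
    have h10 : (1 : ℝ) ≤ Lg ^ 10 := one_le_pow₀ hlogD1
    have h6 : (64 : ℝ) ≤ Lg ^ 6 := by
      have := pow_le_pow_left₀ (by norm_num : (0 : ℝ) ≤ 2) hlogD 6
      norm_num at this
      exact this
    have h16 : Lg ^ 10 + 1 < Lg ^ 16 := by
      have : Lg ^ 16 = Lg ^ 10 * Lg ^ 6 := by ring
      rw [this]
      nlinarith
    have hexp1 : Real.exp (Lg ^ 10) + 1 ≤ Real.exp (Lg ^ 10 + 1) := by
      rw [Real.exp_add]
      have h1 : (2 : ℝ) ≤ Real.exp 1 := by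
        have := Real.add_one_le_exp (1 : ℝ); linarith
      have h0 : 1 ≤ Real.exp (Lg ^ 10) := Real.one_le_exp (by positivity)
      nlinarith
    calc (x : ℝ) ≤ Real.exp (Lg ^ 10) + 1 := hxle
      _ ≤ Real.exp (Lg ^ 10 + 1) := hexp1
      _ < Real.exp (Lg ^ 16) := Real.exp_strictMono h16
  -- Theorem 1 at this `χ_D` and `x`
  haveI := hDne
  obtain ⟨hlo, -⟩ := hD₀ D χ hD₀D hprim hne hquad hL (x : ℝ) hxlow hxhigh
  rw [Nat.floor_natCast] at hlo
  have hx1 : 1 ≤ x := Nat.le_add_left _ _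
  have hx1' : (1 : ℝ) ≤ x := by exact_mod_cast hx1
  have hx0 : (0 : ℝ) < x := by linarith
  -- `x > K^48`, so `x^{1/48} > K`
  have hxD : (D : ℝ) ≤ (x : ℝ) := by
    have h1 : (D : ℝ) = Real.exp Lg := by rw [hLg, Real.exp_log hDpos]
    have h2 : Lg ≤ Lg ^ 10 := by
      calc Lg = Lg ^ 1 := (pow_one _).symm
        _ ≤ Lg ^ 10 := pow_le_pow_right₀ hlogD1 (by norm_num)
    rw [h1]
    exact le_trans (Real.exp_le_exp.mpr h2) hxlow.le
  have hxK : K < (x : ℝ) ^ (1 / 48 : ℝ) := by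
    have hK48 : K ^ (48 : ℕ) < (x : ℝ) := by
      have h1 : K ^ (48 : ℕ) ≤ (⌈K ^ (48 : ℕ)⌉₊ : ℝ) := Nat.le_ceil _
      have h2 : ((⌈K ^ (48 : ℕ)⌉₊ + 1 : ℕ) : ℝ) ≤ (D : ℝ) := by exact_mod_cast hDK
      push_cast at h2
      linarith
    calc K = (K ^ (48 : ℕ)) ^ ((48 : ℕ) : ℝ)⁻¹ :=
        (Real.pow_rpow_inv_natCast hK0 (by norm_num)).symm
      _ < (x : ℝ) ^ ((48 : ℕ) : ℝ)⁻¹ :=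
        Real.rpow_lt_rpow (by positivity) hK48 (by positivity)
      _ = (x : ℝ) ^ (1 / 48 : ℝ) := by norm_num
  -- the chain of inequalities
  have h58 : (x : ℝ) ^ (5 / 8 : ℝ) = (x : ℝ) ^ (29 / 48 : ℝ) * (x : ℝ) ^ (1 / 48 : ℝ) := by
    rw [← Real.rpow_add hx0]; norm_num
  have h2948 : 1 ≤ (x : ℝ) ^ (29 / 48 : ℝ) := Real.one_le_rpow hx1' (by norm_num)
  have hchain : c * (x : ℝ) ^ (5 / 8 : ℝ) ≤ (M + 38784) * (x : ℝ) ^ (29 / 48 : ℝ) := by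
    calc c * (x : ℝ) ^ (5 / 8 : ℝ) ≤ primeSum x := by rw [hc]; exact hlo
      _ ≤ M + 38784 * (x : ℝ) ^ (29 / 48 : ℝ) := hub x hx1
      _ ≤ (M + 38784) * (x : ℝ) ^ (29 / 48 : ℝ) := by nlinarith
  rw [h58] at hchain
  have h48 : c * (x : ℝ) ^ (1 / 48 : ℝ) ≤ M + 38784 := by
    have hpos : (0 : ℝ) < (x : ℝ) ^ (29 / 48 : ℝ) := by positivity
    nlinarith
  have : (x : ℝ) ^ (1 / 48 : ℝ) ≤ K := by
    rw [hK, le_div_iff₀ hc0]; nlinarith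
  linarith

/-- The same conclusion from «exceptional characters of every strength» (the closed hypothesis of
the Parity routes, `∀ A, ExceptionalCharactersOfStrength A`). [cite: Merikoski2024ExceptionalCharacters, §1 Theorem 1 (first sentence)] -/
theorem setOf_prime_sq_add_pow_eight_infinite_of_forall (h : merikoski2024_theorem1)
    (hE : ∀ A : ℝ, ExceptionalCharactersOfStrength A) :
    {p : ℕ | p.Prime ∧ ∃ a b : ℕ, 0 < a ∧ 0 < b ∧ p = a ^ 2 + b ^ 8}.Infinite :=
  setOf_prime_sq_add_pow_eight_infinite h (hE 100)

end Merikoski2024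

end Literature.NumberTheory.LFunctions

end
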